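import Summits.QuantumAdvantage.AdviceFreeQNC0.R1CoDegree39
import HarnessLib

/-!
# Cell qa-qnc0, `p = 3` — tolerance-set ENLARGEMENT puts every read family into the co-degree class of (R1)
# (prover qn-prover-3 g26; sequel of `R1CoDegree39`)

`R1CoDegree39` proves (R1) for read families in which every letter outside the tolerance set `W` is co-read with fewer than
`(log₂N)^C` other outside letters.  The co-read degree is MONOTONE under enlarging `W`, and few letters have large co-degree:
`t · #{i ∉ W : coDeg_W(i) ≥ t} ≤ Σ_k #(T k ∖ W)·(#(T k ∖ W) − 1)` (`≤ N·s²` for outside reads of size `≤ s`) — the tree's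
`AffBells23.sum_cdeg_le` plus Markov.  Hence for EVERY read family and every threshold `t ≥ 1` the enlarged tolerance set
`W := W₀ ∪ {high co-degree letters}` (at most `Σ_k #(T k ∖ W₀)(#(T k ∖ W₀) − 1)/t` new letters, INDEPENDENT of `β` and of any seeds) makes
the twisted bound of `R1CoDegree39` available with exponent `#(supp β ∖ W)/t`:

* `AffBells22.coDegree_mono` — enlarging `W` lowers co-degrees;
* `AffBells22.mul_card_highCoDegree_le` — the counting bound above;
* **`AffBells22.exists_coDegree_tolerance`** — `∃ W ⊇ W₀`, `t·(#W − #W₀) ≤ Σ_k #(T k ∖ W₀)(#(T k ∖ W₀) − 1)`, every letter outside `W`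
  has co-degree `< t` w.r.t. `W`;
* **`AffBells22.norm_twistedWinSum_le_of_enlargedTolerance`** — for every strategy reading `T k`, every `W₀`, `β`, `t ≥ 1`, with that `W`:
  `‖Σ_x e₃(β·x)[OddZeros x ∧ Rel x (g x)]‖ ≤ 2·(39/40)^{#(supp β ∖ W)/t}·2^N` (`N ≥ 3`).

Use (PROVER3-MEMO-gen26 §2, "architecture remark"): a structure step that chooses its tolerance set AFTER this enlargement (budget
`3·#W ≤ N` permitting, e.g. `t = (log₂N)^{2C+2}` costs `≤ N/(log₂N)²` letters) meets only read families of the PROVED co-degree class.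

WHAT THIS IS NOT: no statement about seeds / graded spread surviving the enlargement (planner-owned); crux `stmt-QuantumAdvantage-22907`
untouched.
-/

noncomputable section

namespace Summit.QuantumAdvantage.AdviceFreeQNC0

open Finset Literature.Computability.QuantumComplexity Literature.Computability.QuantumComplexity.RingHLF
open Literature.Computability.MetaComplexity
open scoped Classical

namespace AffBells22

variable {N : ℕ}

/-- **Co-degree is monotone under enlarging the tolerance set.** -/
theorem coDegree_mono (T : Fin N → Finset (Fin N)) {W W' : Finset (Fin N)} (hWW' : W ⊆ W') (i : Fin N) :
    (univ.filter fun i' : Fin N => i' ≠ i ∧ i' ∉ W' ∧ ∃ k, i ∈ T k ∧ i' ∈ T k).card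
      ≤ (univ.filter fun i' : Fin N => i' ≠ i ∧ i' ∉ W ∧ ∃ k, i ∈ T k ∧ i' ∈ T k).card :=
  card_le_card fun i' hi' => by
    obtain ⟨h1, h2, h3⟩ := (mem_filter.mp hi').2
    exact mem_filter.mpr ⟨mem_univ _, h1, fun h => h2 (hWW' h), h3⟩

/-- **Few letters have large co-degree**: `t · #{i ∉ W : coDeg_W(i) ≥ t} ≤ Σ_k #(T k ∖ W)·(#(T k ∖ W) − 1)` (the conflict-degree sum
`AffBells23.sum_cdeg_le` over the outside letters, plus Markov). -/
theorem mul_card_highCoDegree_le (W : Finset (Fin N)) (T : Fin N → Finset (Fin N)) (t : ℕ) :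
    t * (univ.filter fun i : Fin N => i ∉ W ∧
        t ≤ (univ.filter fun i' : Fin N => i' ≠ i ∧ i' ∉ W ∧ ∃ k, i ∈ T k ∧ i' ∈ T k).card).card
      ≤ ∑ k : Fin N, (T k \ W).card * ((T k \ W).card - 1) := by
  classical
  set P := univ.filter (fun i : Fin N => i ∉ W) with hPdef
  set S : Fin N → Finset (Fin N) := fun k => T k \ W with hSdef
  set H := univ.filter (fun i : Fin N => i ∉ W ∧
    t ≤ (univ.filter fun i' : Fin N => i' ≠ i ∧ i' ∉ W ∧ ∃ k, i ∈ T k ∧ i' ∈ T k).card) with hHdef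
  -- the co-degree of an outside letter is its conflict degree inside `P` for the family `S`
  have hcd : ∀ i ∈ P, (univ.filter fun i' : Fin N => i' ≠ i ∧ i' ∉ W ∧ ∃ k, i ∈ T k ∧ i' ∈ T k).card
      ≤ AffBells23.cdeg (univ : Finset (Fin N)) S P i := by
    intro i hi
    have hiW : i ∉ W := (mem_filter.mp hi).2
    unfold AffBells23.cdeg
    refine card_le_card fun i' hi' => ?_
    obtain ⟨h1, h2, k, hik, hi'k⟩ := (mem_filter.mp hi').2
    have hi'P : i' ∈ P := mem_filter.mpr ⟨mem_univ _, h2⟩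
    have hikS : i ∈ S k := mem_sdiff.mpr ⟨hik, hiW⟩
    have hi'kS : i' ∈ S k := mem_sdiff.mpr ⟨hi'k, h2⟩
    simp only [Finset.mem_filter]
    exact ⟨hi'P, h1, k, mem_univ _, hikS, hi'kS⟩
  -- Markov on `H ⊆ P`
  have hHP : H ⊆ P := fun i hi => mem_filter.mpr ⟨mem_univ _, (mem_filter.mp hi).2.1⟩
  have h1 : t * H.card ≤ ∑ i ∈ H, AffBells23.cdeg (univ : Finset (Fin N)) S P i := by
    rw [mul_comm, card_eq_sum_ones, sum_mul, one_mul]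
    exact sum_le_sum fun i hi => le_trans (mem_filter.mp hi).2.2 (hcd i (hHP hi))
  have h2 : ∑ i ∈ H, AffBells23.cdeg (univ : Finset (Fin N)) S P i ≤ ∑ i ∈ P, AffBells23.cdeg (univ : Finset (Fin N)) S P i :=
    sum_le_sum_of_subset_of_nonneg hHP fun _ _ _ => Nat.zero_le _
  have h3 := AffBells23.sum_cdeg_le (univ : Finset (Fin N)) S P
  have h4 : ∀ k, S k ∩ P = S k := by
    intro k
    refine inter_eq_left.mpr fun i hi => mem_filter.mpr ⟨mem_univ _, (mem_sdiff.mp hi).2⟩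
  simp only [h4] at h3
  exact h1.trans (h2.trans h3)

/-- **TOLERANCE ENLARGEMENT**: for every `W₀`, every read family `T` and every threshold `t`, the set `W := W₀ ∪ {i ∉ W₀ : coDeg_{W₀}(i) ≥ t}`
contains `W₀`, has `t·(#W − #W₀) ≤ Σ_k #(T k ∖ W₀)(#(T k ∖ W₀) − 1)` and leaves every letter outside it with co-degree `< t` w.r.t. `W`. -/
theorem exists_coDegree_tolerance (W₀ : Finset (Fin N)) (T : Fin N → Finset (Fin N)) (t : ℕ) :
    ∃ W : Finset (Fin N), W₀ ⊆ W ∧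
      t * (W.card - W₀.card) ≤ ∑ k : Fin N, (T k \ W₀).card * ((T k \ W₀).card - 1) ∧
      ∀ i : Fin N, i ∉ W →
        (univ.filter fun i' : Fin N => i' ≠ i ∧ i' ∉ W ∧ ∃ k, i ∈ T k ∧ i' ∈ T k).card < t := by
  classical
  set H := univ.filter (fun i : Fin N => i ∉ W₀ ∧
    t ≤ (univ.filter fun i' : Fin N => i' ≠ i ∧ i' ∉ W₀ ∧ ∃ k, i ∈ T k ∧ i' ∈ T k).card) with hHdef
  refine ⟨W₀ ∪ H, subset_union_left, ?_, ?_⟩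
  · have hdisj : Disjoint W₀ H := disjoint_left.mpr fun i hi hiH => (mem_filter.mp hiH).2.1 hi
    rw [card_union_of_disjoint hdisj, Nat.add_sub_cancel_left]
    exact mul_card_highCoDegree_le W₀ T t
  · intro i hi
    rw [mem_union, not_or] at hi
    have hlt : (univ.filter fun i' : Fin N => i' ≠ i ∧ i' ∉ W₀ ∧ ∃ k, i ∈ T k ∧ i' ∈ T k).card < t := by
      by_contra h
      exact hi.2 (mem_filter.mpr ⟨mem_univ _, hi.1, not_lt.mp h⟩)
    exact lt_of_le_of_lt (coDegree_mono T (subset_union_left (s₂ := H)) i) hlt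

/-- **(R1)-SHAPED BOUND FOR EVERY READ FAMILY AFTER TOLERANCE ENLARGEMENT.**  For every strategy whose bell `k` reads `T k`, every `W₀`,
`β` and `t ≥ 1`: with `W ⊇ W₀` the enlargement of `exists_coDegree_tolerance` (`t·(#W − #W₀) ≤ Σ_k #(T k ∖ W₀)(#(T k ∖ W₀) − 1)`),
`‖Σ_x e₃(β·x)[OddZeros x ∧ Rel x (g x)]‖ ≤ 2·(39/40)^{#(supp β ∖ W)/t}·2^N` (`N ≥ 3`). -/
theorem norm_twistedWinSum_le_of_enlargedTolerance (hN : 3 ≤ N) (W₀ : Finset (Fin N)) (T : Fin N → Finset (Fin N))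
    (g : Fin N → (Fin N → Bool) → Bool) (hg : ∀ k, ReadsOnly (T k) (g k)) {t : ℕ} (ht : 1 ≤ t) (β : Fin N → ZMod 3) :
    ∃ W : Finset (Fin N), W₀ ⊆ W ∧
      t * (W.card - W₀.card) ≤ ∑ k : Fin N, (T k \ W₀).card * ((T k \ W₀).card - 1) ∧
      ‖∑ x : Fin N → Bool, (ZMod.stdAddChar (∑ i : Fin N, if x i then β i else 0) : ℂ) *
          (if (OddZeros x ∧ RingHLF.Rel x (fun k => g k x)) then (1 : ℂ) else 0)‖
        ≤ 2 * (39 / 40 : ℝ) ^ ((univ.filter fun j : Fin N => j ∉ W ∧ β j ≠ 0).card / t) * (2 : ℝ) ^ N := by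
  obtain ⟨W, hW₀, hcard, hco⟩ := exists_coDegree_tolerance W₀ T t
  refine ⟨W, hW₀, hcard, ?_⟩
  have hco' : ∀ i : Fin N, i ∉ W →
      (univ.filter fun i' : Fin N => i' ≠ i ∧ i' ∉ W ∧ ∃ k, i ∈ T k ∧ i' ∈ T k).card ≤ t - 1 := by
    intro i hi; have := hco i hi; omega
  have h := norm_twistedWinSum_le_of_coDegree hN W T g hg (t - 1) hco' β
  have ht1 : t - 1 + 1 = t := by omega
  rw [ht1] at h
  exact h

end AffBells22

end Summit.QuantumAdvantage.AdviceFreeQNC0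

end
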